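import Literature.Topology.FourManifolds.ReducibleTrisectionSeparatingDisc
import Literature.Topology.FourManifolds.TrisectionCurveFlatCharts
import Literature.Topology.FourManifolds.ReducibleTrisectionNotSimplyConnected
import HarnessLib

/-!
# The compressing discs of a separating reducing curve split their handlebodies in two

Topic `Literature/Topology/FourManifolds`; the fourth proved step (after
`ReducibleTrisectionSeparatingSides.lean`, `ReducibleTrisectionSeparatingDisc.lean`,
`TrisectionCurveFlatCharts.lean`) on the road to the named fact
`Literature.Topology.FourManifolds.Trisection.isConnectedSum_of_reducing_separating`
(Aranda–Zupan, arXiv:2503.04607 §2 p. 6: "if `c` is separating, we can express `𝒯` as a connected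
sum `𝒯 = 𝒯′ # 𝒯″`"; printed proof Meier–Schirmer–Zupan 2016 §3, Prop. 3.5 and proof of Prop. 3.9):
step (P3) of `ReducibleTrisectionSplitting.lean`, `§ Status of the separating fact`, now
UNCONDITIONALLY and in its complete form.  **Everything here is proved; no definitions, no named
facts.**

Let `S` be a Gay–Kirby trisection of the smooth `4`-manifold `X` with central surface
`F = ⋂ l, S l` and handlebodies `H_q = Trisection.spineHandlebody S q` of the spine, `δ` a curve
on `F` which is SEPARATING on `F` (`¬ Trisection.IsNonSeparating S δ`), and `D_q = d(𝔻²) ⊆ H_q`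
a compressing disc bounded by `δ` (`Trisection.BoundsDisc`: `d` a smooth embedding of the closed
disc, `d(∂𝔻²) = δ = d(𝔻²) ∩ F`).

* `exists_signChart_of_isLocalSide` — the interface lemma: a flat chart of `(F, δ)` at `p ∈ δ`
  (`IsGKTrisection.exists_flatChart_of_isCurve`), a local side indicator `(W, s)` of `δ` inside
  `F` at `p` (`IsLocalSide`, supplied for the disc by `exists_isLocalSide_of_disc`) and a side
  function `sd = κ · s` near `p` give a flat chart in which `sd` is `ε` above and `-ε` below `δ` —
  the hypothesis `hchart` of `IsGKTrisection.not_isConnected_spineHandlebody_diff_of_sideCharts`.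
* `IsGKTrisection.not_isConnected_spineHandlebody_diff_range` — **`D_q` separates `H_q`**
  (`H_q ∖ D_q` is not connected), unconditionally.
* `IsGKTrisection.exists_two_sides_spineHandlebody_diff_range` — **exactly two sides, compatible
  with the sides of `δ` on `F`**: `H_q ∖ D_q = U₁ ⊔ U₂` with `U₁`, `U₂` connected, relatively
  open in `H_q`, `closure Uᵢ = Uᵢ ∪ D_q`, every preconnected subset of `H_q ∖ D_q` inside one of
  them, and `F₁ ⊆ U₁`, `F₂ ⊆ U₂` for the two sides `F ∖ δ = F₁ ⊔ F₂` of the curve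
  (`IsGKTrisection.exists_two_sides_of_not_isNonSeparating'`).  (The pieces `Uᵢ ∪ D_q` are the
  genus-`gᵢ` handlebodies `H_q′`, `H_q″` of the two summands `𝒯′`, `𝒯″`; their genus is not
  identified here.)
* `IsGKTrisection.exists_two_sides_spineHandlebody_of_boundsDisc` — the same from
  `Trisection.BoundsDisc S (H_q) δ`.
* `IsGKTrisection.exists_two_sides_union_spineHandlebody_diff` — **two discs**: for `q ≠ r` the
  2-sphere-with-corner `R = D_q ∪_δ D_r` splits `H_q ∪ H_r` — the boundary `∂X_i` of the third
  sector (`Trisection.spineHandlebody_succ_union_spineHandlebody_succ_succ`) — into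
  `V₁ ⊔ V₂`, `Vᵢ = U_qⁱ ∪ U_rⁱ ⊇ Fᵢ` connected, relatively open, `closure Vᵢ = Vᵢ ∪ R`,
  `Vᵢ ∩ F = Fᵢ` (Meier–Schirmer–Zupan's `R_i ⊂ ∂X_i`, proof of Prop. 3.5; step (P3b) of the
  road map, 3-dimensional part).

**Proofs.**  The separation is `not_isConnected_spineHandlebody_diff_of_sideCharts` (a
circle-valued winding argument) fed with the side function of the disc
(`IsGKTrisection.exists_sideFunction_of_disc`, Hirsch's two-sidedness of a simply connected
hypersurface) and the sign charts of the interface lemma.  "Exactly two sides" is the general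
topology of `exists_two_components_of_locally_twoSided` in the connected, locally connected
subspace `H_q`, the local two-sidedness of `D_q` at every point being `exists_isLocalSide_of_disc`
in the slice charts `IsGKTrisection.exists_sliceChart_spineHandlebody`; compatibility with the
sides of `δ`: at a point `p₀ ∈ δ` one local side indicator `s` serves both for `D_q ⊂ H_q` and
for `δ ⊂ F`, the two `F`-sides near `p₀` carry opposite signs of `s` (each preconnected local
`F`-side lies in `F₁` or in `F₂`, and both `F₁`, `F₂` adhere to `p₀`), so `F₁` and `F₂` meet
opposite local `H_q`-sides; if both lay in the same `Uᵢ`, the two local `H_q`-sides at `p₀` would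
lie in `Uᵢ` and `p₀ ∉ closure U_{3-i}`, contradicting `closure Uⱼ = Uⱼ ∪ D_q ∋ p₀`.

## References

* R. Aranda, A. Zupan, *Manifolds with weakly reducible genus-three trisections are standard*,
  arXiv:2503.04607 (2025), §2 p. 6 (reducing curves; the separating case). [ArandaZupan2025]
* J. Meier, T. Schirmer, A. Zupan, *Classification of trisections and the Generalized Property R
  Conjecture*, Proc. AMS 144 (2016), §3, Prop. 3.5 and proof of Prop. 3.9. [MeierSchirmerZupan2016]
* M. W. Hirsch, *Differential Topology*, GTM 33 (1976), Ch. 4, Thm. 4.6. [HirschDT1976]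
-/

noncomputable section

open Set Function Filter Topology Metric
open scoped Manifold ContDiff

namespace Literature.Topology.FourManifolds

universe u

/-! ### Sign charts from local side indicators -/

section SignChart

variable {Y : Type*} [TopologicalSpace Y]

/-- **Sign chart from a flat chart and a local side indicator.**  Let `F ⊆ Y`, `δ ⊆ Y`, `e` a flat
chart of `(F, δ)` at `p ∈ δ` (an open partial homeomorphism of the subspace `F` to `ℝ × ℝ` with
`e p = 0` and `δ = {e₂ = 0}` on its source), `(W, s)` a local side indicator of `δ` inside `F` at
`p` (`IsLocalSide F δ W s`), and `sd` a function with `sd = κ · s` on `F ∖ δ` near `p`, `κ = ±1`.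
Then, after shrinking, the chart has `sd = ε` on `{e₂ > 0}` and `sd = -ε` on `{e₂ < 0}` for one
sign `ε = ±1`: `s` is constant on each (preconnected) half-box and takes both values near `p`.
[folklore] -/
theorem exists_signChart_of_isLocalSide {F δ W : Set Y} {s sd : Y → ℝ} {p : ↥F}
    (hp : (p : Y) ∈ δ) (e : OpenPartialHomeomorph ↥F (ℝ × ℝ)) (hpe : p ∈ e.source) (hep : e p = 0)
    (hδe : ∀ y ∈ e.source, (y : Y) ∈ δ ↔ (e y).2 = 0) (hs : IsLocalSide F δ W s)
    (hpW : (p : Y) ∈ W) {κ : ℝ} (hκ : κ = 1 ∨ κ = -1)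
    (hcomp : ∀ᶠ y in 𝓝 (p : Y), y ∈ F \ δ → sd y = κ * s y) :
    ∃ e' : OpenPartialHomeomorph ↥F (ℝ × ℝ), p ∈ e'.source ∧ e' p = 0 ∧
      (∀ y ∈ e'.source, (y : Y) ∈ δ ↔ (e' y).2 = 0) ∧
      ∃ ε : ℝ, (ε = 1 ∨ ε = -1) ∧ ∀ y ∈ e'.source,
        (0 < (e' y).2 → sd y = ε) ∧ ((e' y).2 < 0 → sd y = -ε) := by
  classical
  -- an open neighbourhood of `p` in `Y` on which the comparison holds
  obtain ⟨U, hUcomp, hUo, hpU⟩ := eventually_nhds_iff.1 hcomp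
  have hA : (Subtype.val ⁻¹' (U ∩ W) : Set ↥F) ∈ 𝓝 p :=
    ((hUo.inter hs.isOpen).preimage continuous_subtype_val).mem_nhds ⟨hpU, hpW⟩
  obtain ⟨W₀, hW₀o, hpW₀, hW₀A, hW₀src, P₁, P₂, hP₁c, hP₂c, hP₁δ, hP₂δ, hWP, -, -, hP₁ne, hP₂ne,
    hP₁W, hP₂W, hP₁pos, hP₂neg⟩ :=
    exists_local_sides_of_flatChart' (δ := (Subtype.val ⁻¹' δ : Set ↥F)) e hpe hep hδe hA
  -- the half-boxes lie in `(W ∩ F) ∖ δ`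
  have hPWF : ∀ y : ↥F, y ∈ P₁ ∪ P₂ → (y : Y) ∈ (W ∩ F) \ δ := by
    intro y hy
    rcases hy with hy | hy
    · exact ⟨⟨(hW₀A (hP₁W hy)).2, y.2⟩, hP₁δ hy⟩
    · exact ⟨⟨(hW₀A (hP₂W hy)).2, y.2⟩, hP₂δ hy⟩
  -- `s` is locally constant on them (in the subspace `F`), hence constant on each
  have hloc : ∀ y : ↥F, y ∈ P₁ ∪ P₂ → ∀ᶠ z : ↥F in 𝓝[univ] y, s z = s y := by
    intro y hy
    rw [nhdsWithin_univ]
    exact (eventually_nhds_subtype_iff F y fun z => s z = s y).2 (hs.eventually_eq y (hPWF y hy))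
  have hconst : ∀ P : Set ↥F, IsPreconnected P → P ⊆ P₁ ∪ P₂ →
      ∀ y₁ ∈ P, ∀ y₂ ∈ P, s y₂ = s y₁ := fun P hP hPsub y₁ h₁ y₂ h₂ =>
    eq_of_isPreconnected_of_eventuallyEq_nhdsWithin (f := fun z : ↥F => s z) hP (subset_univ P)
      (fun y hy => hloc y (hPsub hy)) h₁ h₂
  obtain ⟨y₁, hy₁⟩ := hP₁ne
  obtain ⟨y₂, hy₂⟩ := hP₂ne
  have ha1 : s y₁ = 1 ∨ s y₁ = -1 := hs.sign_eq y₁ (hPWF y₁ (Or.inl hy₁))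
  have hsP₁ : ∀ y ∈ P₁, s y = s y₁ := fun y hy =>
    hconst P₁ hP₁c subset_union_left y₁ hy₁ y hy
  have hsP₂ : ∀ y ∈ P₂, s y = s y₂ := fun y hy =>
    hconst P₂ hP₂c subset_union_right y₂ hy₂ y hy
  -- the two half-boxes carry opposite signs: `p` adheres to the side `{s = -s y₁}`
  have hb : s y₂ = -s y₁ := by
    obtain ⟨G, hGo, hGW⟩ := isOpen_induced_iff.1 hW₀o
    have hpG : (p : Y) ∈ G := by
      have : p ∈ Subtype.val ⁻¹' G := by rw [hGW]; exact hpW₀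
      exact this
    have hcl := hs.mem_closure (p : Y) ⟨hp, hpW⟩ (-s y₁)
      (by rcases ha1 with h | h <;> norm_num [h])
    obtain ⟨y, hyG, ⟨⟨-, hyF⟩, hyδ⟩, hsy⟩ := mem_closure_iff_nhds.1 hcl G (hGo.mem_nhds hpG)
    have hyW₀ : (⟨y, hyF⟩ : ↥F) ∈ W₀ := by
      have : (⟨y, hyF⟩ : ↥F) ∈ Subtype.val ⁻¹' G := hyG
      rwa [hGW] at this
    rcases hWP ⟨hyW₀, hyδ⟩ with h1 | h2
    · have h' : s y = s y₁ := hsP₁ _ h1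
      rw [hsy] at h'
      rcases ha1 with h | h <;> rw [h] at h' <;> norm_num at h'
    · rw [← hsP₂ _ h2]
      exact hsy
  -- the restricted chart
  refine ⟨e.restrOpen W₀ hW₀o, ⟨hpe, hpW₀⟩, hep, fun y hy => hδe y hy.1, κ * s y₁, ?_,
    fun y hy => ?_⟩
  · rcases hκ with h | h <;> rcases ha1 with h' | h' <;> norm_num [h, h']
  · have hyW₀ : y ∈ W₀ := hy.2
    have hyU : (y : Y) ∈ U := (hW₀A hyW₀).1
    have hcmp : (y : Y) ∉ δ → sd y = κ * s y := fun hyδ => hUcomp _ hyU ⟨y.2, hyδ⟩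
    refine ⟨fun hpos => ?_, fun hneg => ?_⟩
    · have hpos' : 0 < (e y).2 := hpos
      have hyδ : (y : Y) ∉ δ := fun h' => (ne_of_gt hpos') ((hδe y hy.1).1 h')
      have hy1 : y ∈ P₁ := by
        rcases hWP ⟨hyW₀, hyδ⟩ with h1 | h2
        · exact h1
        · exact absurd (hP₂neg y h2) (not_lt.2 hpos'.le)
      rw [hcmp hyδ, hsP₁ y hy1]
    · have hneg' : (e y).2 < 0 := hneg
      have hyδ : (y : Y) ∉ δ := fun h' => (ne_of_lt hneg') ((hδe y hy.1).1 h')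
      have hy2 : y ∈ P₂ := by
        rcases hWP ⟨hyW₀, hyδ⟩ with h1 | h2
        · exact absurd (hP₁pos y h1) (not_lt.2 hneg'.le)
        · exact h2
      rw [hcmp hyδ, hsP₂ y hy2, hb]
      ring

end SignChart

/-! ### The disc separates the handlebody (unconditional) -/

section Disc

variable {X : Type u} [TopologicalSpace X] [T2Space X] [SecondCountableTopology X]
  [ChartedSpace (EuclideanSpace ℝ (Fin 4)) X] [IsManifold (𝓡 4) ∞ X]
  {g : ℕ} {k : Fin 3 → ℕ} {S : Fin 3 → Set X}

/-- **A compressing disc of a separating reducing curve separates its handlebody.**  Let `S` be a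
Gay–Kirby trisection of `X`, `δ` a curve on the central surface `F = ⋂ l, S l` which is
separating on `F`, and `d : 𝔻² → X` a smoothly embedded disc in the handlebody `H_q` of the spine
with `d(∂𝔻²) = δ = d(𝔻²) ∩ F` (the data of `Trisection.BoundsDisc S H_q δ`).  Then
`H_q ∖ d(𝔻²)` is not connected.  (Unconditional form of
`IsGKTrisection.not_isConnected_spineHandlebody_diff_of_sideCharts`: the side function is
`IsGKTrisection.exists_sideFunction_of_disc`, the sign charts are `exists_signChart_of_isLocalSide`
over the flat charts `IsGKTrisection.exists_flatChart_of_isCurve`.)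
[cite: ArandaZupan2025, §2 p. 6 (separating reducing curves)]
[cite: MeierSchirmerZupan2016, §3 proof of Proposition 3.9] -/
theorem IsGKTrisection.not_isConnected_spineHandlebody_diff_range (h : IsGKTrisection X g k S)
    {δ : Set X} (hc : Trisection.IsCurve S δ) (hsep : ¬ Trisection.IsNonSeparating S δ)
    (q : Fin 3) {d : (Metric.closedBall (0 : EuclideanSpace ℝ (Fin 2)) 1) → X}
    (hd : Manifold.IsSmoothEmbedding (𝓡∂ 2) (𝓡 4) ∞ d)
    (hdH : range d ⊆ Trisection.spineHandlebody S q)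
    (hdδ : d '' (𝓡∂ 2).boundary (Metric.closedBall (0 : EuclideanSpace ℝ (Fin 2)) 1) = δ)
    (hdF : range d ∩ (⋂ l, S l) = δ) :
    ¬ IsConnected (Trisection.spineHandlebody S q \ range d) := by
  classical
  obtain ⟨O, sd, W, s, hO, hDO, hsd, hzW, hκ, hbd⟩ :=
    h.exists_sideFunction_of_disc q hd hdH hdδ hdF
  haveI := compactSpace_closedBall_two
  have hDc : IsClosed (range d) := (isCompact_range hd.contMDiff.continuous).isClosed
  have hFH : (⋂ l, S l) ⊆ Trisection.spineHandlebody S q := iInter_subset_spineHandlebody S q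
  have hδD : δ ⊆ range d := fun y hy => by
    have : y ∈ range d ∩ ⋂ l, S l := by rw [hdF]; exact hy
    exact this.1
  refine h.not_isConnected_spineHandlebody_diff_of_sideCharts hc hsep q (range d) hDc hdF O hO
    hDO sd hsd fun p hp => ?_
  obtain ⟨e, hpe, hep, hδe⟩ := h.exists_flatChart_of_isCurve hc p hp
  obtain ⟨z, hz⟩ := hδD hp
  have hpW : (p : X) ∈ W z := by rw [← hz]; exact hzW z
  have hzF : d z ∈ ⋂ l, S l := by rw [hz]; exact p.2
  obtain ⟨hLS, -⟩ := hbd z hzF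
  obtain ⟨κ, hκ1, hκev⟩ := hκ z (p : X) ⟨⟨z, hz⟩, hpW⟩
  refine exists_signChart_of_isLocalSide hp e hpe hep hδe hLS hpW hκ1 ?_
  filter_upwards [hκev] with y hy hyF
  exact hy ⟨hFH hyF.1, fun hyD => hyF.2 (by rw [← hdF]; exact ⟨hyD, hyF.1⟩)⟩

omit [T2Space X] [SecondCountableTopology X] [IsManifold (𝓡 4) ∞ X] in
/-- The handlebody `H_q` of the spine of a trisection is connected (it is the image of a
connected `3`-manifold with boundary, `IsGKTrisection.isPathConnected_handlebody`).
[cite: GayKirby2016, Def. 1] -/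
theorem IsGKTrisection.isConnected_spineHandlebody (h : IsGKTrisection X g k S) (q : Fin 3) :
    IsConnected (Trisection.spineHandlebody S q) := by
  rw [Trisection.spineHandlebody_eq_inter]
  exact (h.isPathConnected_handlebody q).isConnected

/-- **The two sides of a compressing disc of a separating reducing curve, compatible with the two
sides of the curve.**  Let `S` be a Gay–Kirby trisection of `X`, `δ` a separating curve on the
central surface `F = ⋂ l, S l` with sides `F ∖ δ = F₁ ⊔ F₂` (preconnected, both adhering to `δ`,
and absorbing every preconnected subset of `F ∖ δ` — the output of
`IsGKTrisection.exists_two_sides_of_not_isNonSeparating'`), and `d : 𝔻² → X` a compressing disc of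
the handlebody `H_q` bounded by `δ` (`d` a smooth embedding, `d(𝔻²) ⊆ H_q`,
`d(∂𝔻²) = δ = d(𝔻²) ∩ F`).  Then `H_q ∖ d(𝔻²) = U₁ ⊔ U₂` with `U₁`, `U₂` connected and relatively
open in `H_q`, `closure Uᵢ = Uᵢ ∪ d(𝔻²)`, every preconnected subset of `H_q ∖ d(𝔻²)` inside `U₁`
or `U₂`, and `F₁ ⊆ U₁`, `F₂ ⊆ U₂`.  (In Meier–Schirmer–Zupan's words, `δ` "decomposes" the
handlebody: `Uᵢ ∪ d(𝔻²)` are the handlebodies of the two summand trisections.)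
[cite: ArandaZupan2025, §2 p. 6 (separating reducing curves)]
[cite: MeierSchirmerZupan2016, §3 proof of Proposition 3.9] -/
theorem IsGKTrisection.exists_two_sides_spineHandlebody_diff_range (h : IsGKTrisection X g k S)
    {δ : Set X} (hc : Trisection.IsCurve S δ) (hsep : ¬ Trisection.IsNonSeparating S δ)
    (q : Fin 3) {d : (Metric.closedBall (0 : EuclideanSpace ℝ (Fin 2)) 1) → X}
    (hd : Manifold.IsSmoothEmbedding (𝓡∂ 2) (𝓡 4) ∞ d)
    (hdH : range d ⊆ Trisection.spineHandlebody S q)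
    (hdδ : d '' (𝓡∂ 2).boundary (Metric.closedBall (0 : EuclideanSpace ℝ (Fin 2)) 1) = δ)
    (hdF : range d ∩ (⋂ l, S l) = δ)
    {F₁ F₂ : Set X} (hF : F₁ ∪ F₂ = (⋂ l, S l) \ δ) (hF₁₂ : Disjoint F₁ F₂)
    (hF₁c : IsPreconnected F₁) (hF₂c : IsPreconnected F₂)
    (hcl₁ : δ ⊆ closure F₁) (hcl₂ : δ ⊆ closure F₂)
    (hFmax : ∀ P ⊆ (⋂ l, S l) \ δ, IsPreconnected P → P ⊆ F₁ ∨ P ⊆ F₂) :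
    ∃ U₁ U₂ : Set X, U₁ ∪ U₂ = Trisection.spineHandlebody S q \ range d ∧ Disjoint U₁ U₂ ∧
      IsConnected U₁ ∧ IsConnected U₂ ∧
      IsOpen (Subtype.val ⁻¹' U₁ : Set ↥(Trisection.spineHandlebody S q)) ∧
      IsOpen (Subtype.val ⁻¹' U₂ : Set ↥(Trisection.spineHandlebody S q)) ∧
      closure U₁ = U₁ ∪ range d ∧ closure U₂ = U₂ ∪ range d ∧
      (∀ P ⊆ Trisection.spineHandlebody S q \ range d, IsPreconnected P → P ⊆ U₁ ∨ P ⊆ U₂) ∧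
      F₁ ⊆ U₁ ∧ F₂ ⊆ U₂ := by
  classical
  set Hq := Trisection.spineHandlebody S q with hHq
  haveI := compactSpace_closedBall_two
  have hDc : IsClosed (range d) := (isCompact_range hd.contMDiff.continuous).isClosed
  have hδF : δ ⊆ ⋂ l, S l := hc.1
  have hFH : (⋂ l, S l) ⊆ Hq := iInter_subset_spineHandlebody S q
  have hHc : IsClosed Hq := h.isClosed_spineHandlebody q
  have hδD : δ ⊆ range d := fun y hy => by
    have : y ∈ range d ∩ ⋂ l, S l := by rw [hdF]; exact hy
    exact this.1
  have hdF' : range d ∩ (⋂ l, S l) = d '' {z | (𝓡∂ 2).IsBoundaryPoint z} := by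
    rw [hdF, ← hdδ]; rfl
  have hFδsub : (⋂ l, S l) \ δ ⊆ Hq \ range d := fun y hy =>
    ⟨hFH hy.1, fun hyD => hy.2 (by rw [← hdF]; exact ⟨hyD, hy.1⟩)⟩
  have hF₁sub : F₁ ⊆ Hq \ range d := fun y hy => hFδsub (hF ▸ Or.inl hy)
  have hF₂sub : F₂ ⊆ Hq \ range d := fun y hy => hFδsub (hF ▸ Or.inr hy)
  -- local side indicators at every point of the disc, `F`-sides at the points of `δ`
  have hloc : ∀ z, ∃ (W : Set X) (s : X → ℝ), d z ∈ W ∧ IsLocalSide Hq (range d) W s ∧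
      (d z ∈ (⋂ l, S l) → IsLocalSide (⋂ l, S l) δ W s) := by
    intro z
    obtain ⟨Ξ, V, hΞ, hVo, hzV, hVΞ, hHV, hFV⟩ :=
      h.exists_sliceChart_spineHandlebody q (hdH (mem_range_self z))
    obtain ⟨W, s, hzW, hWs, hWF⟩ :=
      exists_isLocalSide_of_disc hd hdH hdF' z hΞ hVo hzV hVΞ hHV hFV
    refine ⟨W, s, hzW, hWs, fun hz => ?_⟩
    have h1 := (hWF hz).1
    rwa [hdF] at h1
  -- the subspace `H_q`
  haveI : LocallyPathConnectedSpace ↥Hq := h.locallyPathConnectedSpace_spineHandlebody q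
  haveI : ConnectedSpace ↥Hq := isConnected_iff_connectedSpace.1 (h.isConnected_spineHandlebody q)
  set DH : Set ↥Hq := Subtype.val ⁻¹' range d with hDHdef
  have himage : Subtype.val '' DH = range d := by
    ext y
    simp only [hDHdef, mem_image, mem_preimage]
    exact ⟨fun ⟨w, hw, hwy⟩ => hwy ▸ hw, fun hy => ⟨⟨y, hdH hy⟩, hy, rfl⟩⟩
  have hcimage : Subtype.val '' DHᶜ = Hq \ range d := by
    ext y
    simp only [hDHdef, mem_image, mem_compl_iff, mem_preimage, Set.mem_sdiff]
    exact ⟨fun ⟨w, hw, hwy⟩ => hwy ▸ ⟨w.2, hw⟩, fun ⟨hyH, hyD⟩ => ⟨⟨y, hyH⟩, hyD, rfl⟩⟩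
  have hDHc : IsClosed DH := hDc.preimage continuous_subtype_val
  haveI : PreconnectedSpace ↥(Metric.closedBall (0 : EuclideanSpace ℝ (Fin 2)) 1) :=
    isPreconnected_iff_preconnectedSpace.1 (convex_closedBall _ _).isPreconnected
  have hDHconn : IsPreconnected DH := by
    rw [← Topology.IsInducing.subtypeVal.isPreconnected_image, himage]
    exact isPreconnected_range hd.contMDiff.continuous
  -- the sides of a local side indicator, lifted to the subspace
  have hlift_pre : ∀ (T : Set X), T ⊆ Hq → IsPreconnected T →
      IsPreconnected (Subtype.val ⁻¹' T : Set ↥Hq) := by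
    intro T hT hTc
    rw [← Topology.IsInducing.subtypeVal.isPreconnected_image]
    have : Subtype.val '' (Subtype.val ⁻¹' T : Set ↥Hq) = T := by
      rw [Subtype.image_preimage_coe, inter_eq_right.2 hT]
    rw [this]
    exact hTc
  -- local two-sidedness of the disc in `H_q`
  have hlocH : ∀ p ∈ DH, ∃ W' ∈ 𝓝 p, ∃ P₁ P₂ : Set ↥Hq, IsPreconnected P₁ ∧ IsPreconnected P₂ ∧
      P₁ ⊆ DHᶜ ∧ P₂ ⊆ DHᶜ ∧ W' \ DH ⊆ P₁ ∪ P₂ ∧ W' ∩ DH ⊆ closure P₁ ∧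
      W' ∩ DH ⊆ closure P₂ := by
    rintro p ⟨z, hz⟩
    obtain ⟨W, s, hzW, hWs, -⟩ := hloc z
    have hpW : (p : X) ∈ W := by rw [← hz]; exact hzW
    obtain ⟨V, hV, hVW, hP, hN⟩ :=
      hWs.exists_nhds (p : X) ⟨⟨z, hz⟩, hpW⟩ W (hWs.isOpen.mem_nhds hpW)
    have hmono : IsLocalSide Hq (range d) (interior V) s :=
      hWs.mono isOpen_interior (interior_subset.trans fun x hx => (hVW hx).1)
    have hside_sub : ∀ σ : ℝ, {y' | y' ∈ (V ∩ Hq) \ range d ∧ s y' = σ} ⊆ Hq :=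
      fun σ y hy => hy.1.1.2
    have hcl : ∀ σ : ℝ, σ = 1 ∨ σ = -1 → (Subtype.val ⁻¹' interior V : Set ↥Hq) ∩ DH ⊆
        closure (Subtype.val ⁻¹' {y' | y' ∈ (V ∩ Hq) \ range d ∧ s y' = σ}) := by
      rintro σ hσ y ⟨hyV, hyD⟩
      have h1 := hmono.mem_closure (y : X) ⟨hyD, hyV⟩ σ hσ
      rw [Topology.IsInducing.subtypeVal.closure_eq_preimage_closure_image]
      show (y : X) ∈ closure (Subtype.val '' _)
      refine closure_mono ?_ h1
      rintro x ⟨⟨⟨hxV, hxH⟩, hxD⟩, hsx⟩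
      exact ⟨⟨x, hxH⟩, ⟨⟨⟨interior_subset hxV, hxH⟩, hxD⟩, hsx⟩, rfl⟩
    refine ⟨Subtype.val ⁻¹' interior V,
      (isOpen_interior.preimage continuous_subtype_val).mem_nhds (mem_interior_iff_mem_nhds.2 hV),
      Subtype.val ⁻¹' {y' | y' ∈ (V ∩ Hq) \ range d ∧ s y' = 1},
      Subtype.val ⁻¹' {y' | y' ∈ (V ∩ Hq) \ range d ∧ s y' = -1},
      hlift_pre _ (hside_sub 1) hP, hlift_pre _ (hside_sub (-1)) hN,
      fun y hy hyD => hy.1.2 hyD, fun y hy hyD => hy.1.2 hyD, ?_,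
      hcl 1 (Or.inl rfl), hcl (-1) (Or.inr rfl)⟩
    rintro y ⟨hyV, hyD⟩
    have hyV' : (y : X) ∈ V := interior_subset hyV
    have hy' : (y : X) ∈ (V ∩ Hq) \ range d := ⟨⟨hyV', y.2⟩, hyD⟩
    rcases hWs.sign_eq y ⟨⟨(hVW hyV').1, y.2⟩, hyD⟩ with h1 | h1
    · exact Or.inl ⟨hy', h1⟩
    · exact Or.inr ⟨hy', h1⟩
  -- the complement is disconnected (the separation theorem) and non-empty
  obtain ⟨p₀, hp₀⟩ := hc.nonempty
  have hF₁ne : F₁.Nonempty := closure_nonempty_iff.1 ⟨p₀, hcl₁ hp₀⟩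
  have hnotpre : ¬ IsPreconnected DHᶜ := by
    intro hpre
    apply h.not_isConnected_spineHandlebody_diff_range hc hsep q hd hdH hdδ hdF
    refine ⟨hF₁ne.mono hF₁sub, ?_⟩
    rw [← hcimage]
    exact hpre.image _ continuous_subtype_val.continuousOn
  obtain ⟨C₁, C₂, hC₁o, hC₂o, hC₁c, hC₂c, hCdisj, hCunion, hCcl₁, hCcl₂, hCmax⟩ :=
    exists_two_components_of_locally_twoSided hDHconn hDHc hlocH hnotpre
  -- `F₁` and `F₂` lie in different components
  have hFi : ∀ (Fi : Set X), IsPreconnected Fi → Fi ⊆ Hq \ range d →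
      (Subtype.val ⁻¹' Fi : Set ↥Hq) ⊆ C₁ ∨ (Subtype.val ⁻¹' Fi : Set ↥Hq) ⊆ C₂ :=
    fun Fi hFic hFisub => hCmax _ (fun y hy => (hFisub hy).2)
      (hlift_pre Fi (fun y hy => (hFisub hy).1) hFic)
  have hnotsame : ∀ (Ca Cb : Set ↥Hq), Disjoint Ca Cb → Ca ∪ Cb = DHᶜ → closure Cb = Cb ∪ DH →
      (∀ P ⊆ DHᶜ, IsPreconnected P → P ⊆ Ca ∨ P ⊆ Cb) →
      ¬ ((Subtype.val ⁻¹' F₁ : Set ↥Hq) ⊆ Ca ∧ (Subtype.val ⁻¹' F₂ : Set ↥Hq) ⊆ Ca) := by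
    rintro Ca Cb hdisj hunion hclb hmax ⟨h₁, h₂⟩
    obtain ⟨z₀, hz₀⟩ := hδD hp₀
    obtain ⟨W, s, hzW, hWs, hWF⟩ := hloc z₀
    have hp₀W : p₀ ∈ W := by rw [← hz₀]; exact hzW
    have hp₀F : p₀ ∈ ⋂ l, S l := hδF hp₀
    have hFs : IsLocalSide (⋂ l, S l) δ W s := hWF (by rw [hz₀]; exact hp₀F)
    -- a neighbourhood with preconnected `H_q`-sides, and inside it one with preconnected `F`-sides
    obtain ⟨V, hV, hVW, hP, hN⟩ :=
      hWs.exists_nhds p₀ ⟨⟨z₀, hz₀⟩, hp₀W⟩ W (hWs.isOpen.mem_nhds hp₀W)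
    obtain ⟨VF, hVF, hVFV, hPF, hNF⟩ :=
      hFs.exists_nhds p₀ ⟨hp₀, hp₀W⟩ (interior V) (interior_mem_nhds.2 hV)
    -- points of `F₁`, `F₂` near `p₀`
    obtain ⟨y₁, hy₁V, hy₁⟩ := mem_closure_iff_nhds.1 (hcl₁ hp₀) (interior VF) (interior_mem_nhds.2 hVF)
    obtain ⟨y₂, hy₂V, hy₂⟩ := mem_closure_iff_nhds.1 (hcl₂ hp₀) (interior VF) (interior_mem_nhds.2 hVF)
    have hy₁' : y₁ ∈ (⋂ l, S l) \ δ := hF ▸ Or.inl hy₁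
    have hy₂' : y₂ ∈ (⋂ l, S l) \ δ := hF ▸ Or.inr hy₂
    have hy₁W : y₁ ∈ W := (hVFV (interior_subset hy₁V)).2
    have hy₂W : y₂ ∈ W := (hVFV (interior_subset hy₂V)).2
    have hs₁ : s y₁ = 1 ∨ s y₁ = -1 := hFs.sign_eq y₁ ⟨⟨hy₁W, hy₁'.1⟩, hy₁'.2⟩
    have hs₂ : s y₂ = 1 ∨ s y₂ = -1 := hFs.sign_eq y₂ ⟨⟨hy₂W, hy₂'.1⟩, hy₂'.2⟩
    -- the `F`-sides through `y₁`, `y₂` lie in `F₁`, `F₂` respectively, so the signs differ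
    have hT : ∀ σ : ℝ, IsPreconnected {y' | y' ∈ (VF ∩ ⋂ l, S l) \ δ ∧ s y' = σ} →
        y₁ ∈ {y' | y' ∈ (VF ∩ ⋂ l, S l) \ δ ∧ s y' = σ} →
        y₂ ∉ {y' | y' ∈ (VF ∩ ⋂ l, S l) \ δ ∧ s y' = σ} := by
      intro σ hTc h1 h2
      rcases hFmax _ (fun y hy => ⟨hy.1.1.2, hy.1.2⟩) hTc with hT1 | hT2
      · exact Set.disjoint_left.1 hF₁₂ (hT1 h2) hy₂
      · exact Set.disjoint_left.1 hF₁₂ hy₁ (hT2 h1)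
    have hsign : s y₂ = -s y₁ := by
      have hm₁ : y₁ ∈ {y' | y' ∈ (VF ∩ ⋂ l, S l) \ δ ∧ s y' = s y₁} :=
        ⟨⟨⟨interior_subset hy₁V, hy₁'.1⟩, hy₁'.2⟩, rfl⟩
      have hm₂ : ∀ σ, s y₂ = σ → y₂ ∈ {y' | y' ∈ (VF ∩ ⋂ l, S l) \ δ ∧ s y' = σ} := fun σ hσ =>
        ⟨⟨⟨interior_subset hy₂V, hy₂'.1⟩, hy₂'.2⟩, hσ⟩
      rcases hs₁ with h1 | h1 <;> rcases hs₂ with h2 | h2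
      · exact absurd (hm₂ _ h2) (h1 ▸ hT 1 hPF (h1 ▸ hm₁))
      · rw [h1, h2]
      · rw [h1, h2]; norm_num
      · exact absurd (hm₂ _ h2) (h1 ▸ hT (-1) hNF (h1 ▸ hm₁))
    -- the `H_q`-sides through `y₁`, `y₂`
    set Sσ : ℝ → Set X := fun σ => {y' | y' ∈ (V ∩ Hq) \ range d ∧ s y' = σ} with hSσ
    have hSpre : ∀ σ, σ = 1 ∨ σ = -1 → IsPreconnected (Subtype.val ⁻¹' Sσ σ : Set ↥Hq) := by
      rintro σ (rfl | rfl)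
      · exact hlift_pre _ (fun y hy => hy.1.1.2) hP
      · exact hlift_pre _ (fun y hy => hy.1.1.2) hN
    have hSsub : ∀ σ, (Subtype.val ⁻¹' Sσ σ : Set ↥Hq) ⊆ DHᶜ := fun σ y hy hyD => hy.1.2 hyD
    have hyS : ∀ y ∈ interior VF, y ∈ Hq \ range d → y ∈ Sσ (s y) := fun y hyV hy =>
      ⟨⟨⟨interior_subset (hVFV (interior_subset hyV)).1, hy.1⟩, hy.2⟩, rfl⟩
    have hy₁S : (⟨y₁, (hF₁sub hy₁).1⟩ : ↥Hq) ∈ (Subtype.val ⁻¹' Sσ (s y₁) : Set ↥Hq) :=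
      hyS y₁ hy₁V (hF₁sub hy₁)
    have hy₂S : (⟨y₂, (hF₂sub hy₂).1⟩ : ↥Hq) ∈ (Subtype.val ⁻¹' Sσ (s y₂) : Set ↥Hq) :=
      hyS y₂ hy₂V (hF₂sub hy₂)
    -- both lie in `Ca` (they meet `F₁ ⊆ Ca`, `F₂ ⊆ Ca`)
    have hinCa : ∀ σ, σ = 1 ∨ σ = -1 → ∀ y : ↥Hq, y ∈ (Subtype.val ⁻¹' Sσ σ : Set ↥Hq) →
        y ∈ Ca → (Subtype.val ⁻¹' Sσ σ : Set ↥Hq) ⊆ Ca := by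
      intro σ hσ y hy hyCa
      rcases hmax _ (hSsub σ) (hSpre σ hσ) with h' | h'
      · exact h'
      · exact absurd (h' hy) (Set.disjoint_left.1 hdisj hyCa)
    have hS₁ : (Subtype.val ⁻¹' Sσ (s y₁) : Set ↥Hq) ⊆ Ca := hinCa _ hs₁ _ hy₁S (h₁ hy₁)
    have hS₂ : (Subtype.val ⁻¹' Sσ (s y₂) : Set ↥Hq) ⊆ Ca := hinCa _ hs₂ _ hy₂S (h₂ hy₂)
    -- but `p₀` adheres to `Cb`
    have hp₀cl : (⟨p₀, hFH hp₀F⟩ : ↥Hq) ∈ closure Cb := by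
      rw [hclb]; exact Or.inr (hδD hp₀)
    obtain ⟨w, hwV, hwCb⟩ := mem_closure_iff_nhds.1 hp₀cl (Subtype.val ⁻¹' interior V)
      ((isOpen_interior.preimage continuous_subtype_val).mem_nhds (mem_interior_iff_mem_nhds.2 hV))
    have hwD : (w : X) ∉ range d := fun hwD => (hunion.symm ▸ Or.inr hwCb : w ∈ DHᶜ) hwD
    have hwside : (w : X) ∈ (V ∩ Hq) \ range d := ⟨⟨interior_subset hwV, w.2⟩, hwD⟩
    have hws : s w = 1 ∨ s w = -1 :=
      hWs.sign_eq w ⟨⟨(hVW (interior_subset hwV)).1, w.2⟩, hwD⟩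
    have hwCa : w ∈ Ca := by
      have hw' : ∀ σ, s w = σ → w ∈ (Subtype.val ⁻¹' Sσ σ : Set ↥Hq) := fun σ hσ => ⟨hwside, hσ⟩
      rcases hs₁ with h1 | h1 <;> rcases hws with h3 | h3
      · exact hS₁ (hw' _ (h3.trans h1.symm))
      · exact hS₂ (hw' _ (by rw [hsign, h1, h3]))
      · exact hS₂ (hw' _ (by rw [hsign, h1, h3]; norm_num))
      · exact hS₁ (hw' _ (h3.trans h1.symm))
    exact Set.disjoint_left.1 hdisj hwCa hwCb
  -- assembly
  have finish : ∀ (Ca Cb : Set ↥Hq), IsOpen Ca → IsOpen Cb → IsConnected Ca → IsConnected Cb →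
      Disjoint Ca Cb → Ca ∪ Cb = DHᶜ → closure Ca = Ca ∪ DH → closure Cb = Cb ∪ DH →
      (∀ P ⊆ DHᶜ, IsPreconnected P → P ⊆ Ca ∨ P ⊆ Cb) →
      (Subtype.val ⁻¹' F₁ : Set ↥Hq) ⊆ Ca → (Subtype.val ⁻¹' F₂ : Set ↥Hq) ⊆ Cb →
      ∃ U₁ U₂ : Set X, U₁ ∪ U₂ = Hq \ range d ∧ Disjoint U₁ U₂ ∧
        IsConnected U₁ ∧ IsConnected U₂ ∧
        IsOpen (Subtype.val ⁻¹' U₁ : Set ↥Hq) ∧ IsOpen (Subtype.val ⁻¹' U₂ : Set ↥Hq) ∧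
        closure U₁ = U₁ ∪ range d ∧ closure U₂ = U₂ ∪ range d ∧
        (∀ P ⊆ Hq \ range d, IsPreconnected P → P ⊆ U₁ ∨ P ⊆ U₂) ∧ F₁ ⊆ U₁ ∧ F₂ ⊆ U₂ := by
    intro Ca Cb hao hbo hac hbc hdisj hunion hcla hclb hmax h₁ h₂
    have hce : Topology.IsClosedEmbedding (Subtype.val : ↥Hq → X) := hHc.isClosedEmbedding_subtypeVal
    have hclos : ∀ (C : Set ↥Hq), closure C = C ∪ DH →
        closure (Subtype.val '' C) = Subtype.val '' C ∪ range d := fun C hC => by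
      rw [hce.closure_image_eq, hC, image_union, himage]
    have hpre : ∀ (C : Set ↥Hq), Subtype.val ⁻¹' (Subtype.val '' C) = C := fun C =>
      Subtype.val_injective.preimage_image C
    refine ⟨Subtype.val '' Ca, Subtype.val '' Cb, ?_, ?_,
      hac.image _ continuous_subtype_val.continuousOn, hbc.image _ continuous_subtype_val.continuousOn,
      ?_, ?_, hclos Ca hcla, hclos Cb hclb, fun P hP hPc => ?_, fun y hy => ?_, fun y hy => ?_⟩
    · rw [← image_union, hunion, hcimage]
    · exact (Set.disjoint_image_iff Subtype.val_injective).2 hdisj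
    · rw [hpre]; exact hao
    · rw [hpre]; exact hbo
    · have hP' : (Subtype.val ⁻¹' P : Set ↥Hq) ⊆ DHᶜ := fun y hy hyD => (hP hy).2 hyD
      rcases hmax _ hP' (hlift_pre P (fun y hy => (hP hy).1) hPc) with h' | h'
      · exact Or.inl fun y hy => ⟨⟨y, (hP hy).1⟩, h' hy, rfl⟩
      · exact Or.inr fun y hy => ⟨⟨y, (hP hy).1⟩, h' hy, rfl⟩
    · exact ⟨⟨y, (hF₁sub hy).1⟩, h₁ hy, rfl⟩
    · exact ⟨⟨y, (hF₂sub hy).1⟩, h₂ hy, rfl⟩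
  have hmax' : ∀ P ⊆ DHᶜ, IsPreconnected P → P ⊆ C₂ ∨ P ⊆ C₁ := fun P hP hPc =>
    (hCmax P hP hPc).symm
  rcases hFi F₁ hF₁c hF₁sub with h1 | h1 <;> rcases hFi F₂ hF₂c hF₂sub with h2 | h2
  · exact absurd ⟨h1, h2⟩ (hnotsame C₁ C₂ hCdisj hCunion hCcl₂ hCmax)
  · exact finish C₁ C₂ hC₁o hC₂o hC₁c hC₂c hCdisj hCunion hCcl₁ hCcl₂ hCmax h1 h2
  · exact finish C₂ C₁ hC₂o hC₁o hC₂c hC₁c hCdisj.symm (union_comm C₂ C₁ ▸ hCunion) hCcl₂ hCcl₁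
      hmax' h1 h2
  · exact absurd ⟨h1, h2⟩ (hnotsame C₂ C₁ hCdisj.symm (union_comm C₂ C₁ ▸ hCunion) hCcl₁ hmax')

/-- **The handlebodies of the spine split along the compressing discs of a separating reducing
curve** (`Trisection.BoundsDisc` form).  For a Gay–Kirby trisection, a separating curve `δ` on the
central surface and `q : Fin 3` with `Trisection.BoundsDisc S (H_q) δ`: there is a compressing
disc `d` (smooth embedding of `𝔻²` into `H_q`, `d(∂𝔻²) = δ = d(𝔻²) ∩ F`) such that
`H_q ∖ d(𝔻²) = U₁ ⊔ U₂`, connected, relatively open, `closure Uᵢ = Uᵢ ∪ d(𝔻²)`, maximal, with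
`F₁ ⊆ U₁`, `F₂ ⊆ U₂` for the two sides `F ∖ δ = F₁ ⊔ F₂` of
`IsGKTrisection.exists_two_sides_of_not_isNonSeparating'`.
[cite: ArandaZupan2025, §2 p. 6 (separating reducing curves)]
[cite: MeierSchirmerZupan2016, §3 proof of Proposition 3.9] -/
theorem IsGKTrisection.exists_two_sides_spineHandlebody_of_boundsDisc (h : IsGKTrisection X g k S)
    {δ : Set X} (hc : Trisection.IsCurve S δ) (hsep : ¬ Trisection.IsNonSeparating S δ)
    {F₁ F₂ : Set X} (hF : F₁ ∪ F₂ = (⋂ l, S l) \ δ) (hF₁₂ : Disjoint F₁ F₂)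
    (hF₁c : IsPreconnected F₁) (hF₂c : IsPreconnected F₂)
    (hcl₁ : δ ⊆ closure F₁) (hcl₂ : δ ⊆ closure F₂)
    (hFmax : ∀ P ⊆ (⋂ l, S l) \ δ, IsPreconnected P → P ⊆ F₁ ∨ P ⊆ F₂)
    (q : Fin 3) (hD : Trisection.BoundsDisc S (Trisection.spineHandlebody S q) δ) :
    ∃ d : (Metric.closedBall (0 : EuclideanSpace ℝ (Fin 2)) 1) → X,
      Manifold.IsSmoothEmbedding (𝓡∂ 2) (𝓡 4) ∞ d ∧ range d ⊆ Trisection.spineHandlebody S q ∧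
      d '' (𝓡∂ 2).boundary (Metric.closedBall (0 : EuclideanSpace ℝ (Fin 2)) 1) = δ ∧
      range d ∩ (⋂ l, S l) = δ ∧
      ∃ U₁ U₂ : Set X, U₁ ∪ U₂ = Trisection.spineHandlebody S q \ range d ∧ Disjoint U₁ U₂ ∧
        IsConnected U₁ ∧ IsConnected U₂ ∧
        IsOpen (Subtype.val ⁻¹' U₁ : Set ↥(Trisection.spineHandlebody S q)) ∧
        IsOpen (Subtype.val ⁻¹' U₂ : Set ↥(Trisection.spineHandlebody S q)) ∧
        closure U₁ = U₁ ∪ range d ∧ closure U₂ = U₂ ∪ range d ∧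
        (∀ P ⊆ Trisection.spineHandlebody S q \ range d, IsPreconnected P → P ⊆ U₁ ∨ P ⊆ U₂) ∧
        F₁ ⊆ U₁ ∧ F₂ ⊆ U₂ := by
  obtain ⟨d, hd, hdH, hdδ, hdF⟩ := hD
  exact ⟨d, hd, hdH, hdδ, hdF, h.exists_two_sides_spineHandlebody_diff_range hc hsep q hd hdH hdδ
    hdF hF hF₁₂ hF₁c hF₂c hcl₁ hcl₂ hFmax⟩


/-! ### Two discs: the sphere `D_q ∪ D_r` splits `H_q ∪ H_r` (the boundary of the third sector) -/

omit [TopologicalSpace X] [T2Space X] [SecondCountableTopology X]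
  [ChartedSpace (EuclideanSpace ℝ (Fin 4)) X] [IsManifold (𝓡 4) ∞ X] in
/-- The union of the two handlebodies of the spine adjacent to the sector `S i` is the part of
`S i` meeting the other two sectors (its boundary `∂X_i = H_{i+2} ∪ H_{i+1}` in Gay–Kirby's
notation; cf. `IsGKTrisection.isPathConnected_inter_union`). [cite: GayKirby2016, Def. 1] -/
theorem Trisection.spineHandlebody_succ_union_spineHandlebody_succ_succ (S : Fin 3 → Set X)
    (i : Fin 3) :
    Trisection.spineHandlebody S (i + 1) ∪ Trisection.spineHandlebody S (i + 2) =
      S i ∩ (S (i + 1) ∪ S (i + 2)) := by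
  obtain ⟨h1, h2, h3, h4⟩ := fin3_add i
  rw [Trisection.spineHandlebody_eq_inter, Trisection.spineHandlebody_eq_inter, h1, h2, h3, h4]
  ext x
  simp only [mem_union, mem_inter_iff]
  tauto

/-- **The sphere `R = D_q ∪ D_r` splits `H_q ∪ H_r` in two, compatibly with the sides of `δ`.**
Let `S` be a Gay–Kirby trisection of `X`, `δ` a separating curve on the central surface `F` with
sides `F ∖ δ = F₁ ⊔ F₂` (as output by `IsGKTrisection.exists_two_sides_of_not_isNonSeparating'`),
`q ≠ r`, and `d_q`, `d_r` compressing discs of `H_q`, `H_r` bounded by `δ`.  Then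
`(H_q ∪ H_r) ∖ (d_q(𝔻²) ∪ d_r(𝔻²)) = V₁ ⊔ V₂` with `V₁`, `V₂` connected, relatively open in
`H_q ∪ H_r`, `closure Vᵢ = Vᵢ ∪ d_q(𝔻²) ∪ d_r(𝔻²)`, every preconnected subset of the complement
inside `V₁` or `V₂`, and `F₁ ⊆ V₁`, `F₂ ⊆ V₂`.  (`H_q ∪ H_r = ∂X_i` for the third index `i`, by
`Trisection.spineHandlebody_succ_union_spineHandlebody_succ_succ`, and `D_q ∪_δ D_r` is the
2-sphere `R_i` of Meier–Schirmer–Zupan's proof of Prop. 3.5, which there bounds the 3-ball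
`B_i ⊆ X_i`; here only its separation of `∂X_i` is recorded.)
[cite: MeierSchirmerZupan2016, §3 proof of Proposition 3.5 and of Proposition 3.9]
[cite: ArandaZupan2025, §2 p. 6 (separating reducing curves)] -/
theorem IsGKTrisection.exists_two_sides_union_spineHandlebody_diff (h : IsGKTrisection X g k S)
    {δ : Set X} (hc : Trisection.IsCurve S δ) (hsep : ¬ Trisection.IsNonSeparating S δ)
    {F₁ F₂ : Set X} (hF : F₁ ∪ F₂ = (⋂ l, S l) \ δ) (hF₁₂ : Disjoint F₁ F₂)
    (hF₁c : IsPreconnected F₁) (hF₂c : IsPreconnected F₂)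
    (hcl₁ : δ ⊆ closure F₁) (hcl₂ : δ ⊆ closure F₂)
    (hFmax : ∀ P ⊆ (⋂ l, S l) \ δ, IsPreconnected P → P ⊆ F₁ ∨ P ⊆ F₂)
    {q r : Fin 3} (hqr : q ≠ r)
    {dq : (Metric.closedBall (0 : EuclideanSpace ℝ (Fin 2)) 1) → X}
    (hdq : Manifold.IsSmoothEmbedding (𝓡∂ 2) (𝓡 4) ∞ dq)
    (hdqH : range dq ⊆ Trisection.spineHandlebody S q)
    (hdqδ : dq '' (𝓡∂ 2).boundary (Metric.closedBall (0 : EuclideanSpace ℝ (Fin 2)) 1) = δ)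
    (hdqF : range dq ∩ (⋂ l, S l) = δ)
    {dr : (Metric.closedBall (0 : EuclideanSpace ℝ (Fin 2)) 1) → X}
    (hdr : Manifold.IsSmoothEmbedding (𝓡∂ 2) (𝓡 4) ∞ dr)
    (hdrH : range dr ⊆ Trisection.spineHandlebody S r)
    (hdrδ : dr '' (𝓡∂ 2).boundary (Metric.closedBall (0 : EuclideanSpace ℝ (Fin 2)) 1) = δ)
    (hdrF : range dr ∩ (⋂ l, S l) = δ) :
    ∃ V₁ V₂ : Set X,
      V₁ ∪ V₂ = (Trisection.spineHandlebody S q ∪ Trisection.spineHandlebody S r) \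
        (range dq ∪ range dr) ∧ Disjoint V₁ V₂ ∧ IsConnected V₁ ∧ IsConnected V₂ ∧
      IsOpen (Subtype.val ⁻¹' V₁ :
        Set ↥(Trisection.spineHandlebody S q ∪ Trisection.spineHandlebody S r)) ∧
      IsOpen (Subtype.val ⁻¹' V₂ :
        Set ↥(Trisection.spineHandlebody S q ∪ Trisection.spineHandlebody S r)) ∧
      closure V₁ = V₁ ∪ (range dq ∪ range dr) ∧ closure V₂ = V₂ ∪ (range dq ∪ range dr) ∧
      (∀ P ⊆ (Trisection.spineHandlebody S q ∪ Trisection.spineHandlebody S r) \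
        (range dq ∪ range dr), IsPreconnected P → P ⊆ V₁ ∨ P ⊆ V₂) ∧
      F₁ ⊆ V₁ ∧ F₂ ⊆ V₂ ∧ V₁ ∩ (⋂ l, S l) = F₁ ∧ V₂ ∩ (⋂ l, S l) = F₂ := by
  classical
  set Hq := Trisection.spineHandlebody S q with hHq
  set Hr := Trisection.spineHandlebody S r with hHr
  obtain ⟨A₁, A₂, hAu, hAd, hA₁c, hA₂c, hA₁o, hA₂o, hAcl₁, hAcl₂, -, hFA₁, hFA₂⟩ :=
    h.exists_two_sides_spineHandlebody_diff_range hc hsep q hdq hdqH hdqδ hdqF hF hF₁₂ hF₁c hF₂c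
      hcl₁ hcl₂ hFmax
  obtain ⟨B₁, B₂, hBu, hBd, hB₁c, hB₂c, hB₁o, hB₂o, hBcl₁, hBcl₂, -, hFB₁, hFB₂⟩ :=
    h.exists_two_sides_spineHandlebody_diff_range hc hsep r hdr hdrH hdrδ hdrF hF hF₁₂ hF₁c hF₂c
      hcl₁ hcl₂ hFmax
  have hHH : Hq ∩ Hr ⊆ ⋂ l, S l := spineHandlebody_inter_spineHandlebody_subset S hqr
  have hHqc : IsClosed Hq := h.isClosed_spineHandlebody q
  have hHrc : IsClosed Hr := h.isClosed_spineHandlebody r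
  have hδDq : δ ⊆ range dq := fun y hy => by
    have : y ∈ range dq ∩ ⋂ l, S l := by rw [hdqF]; exact hy
    exact this.1
  have hδDr : δ ⊆ range dr := fun y hy => by
    have : y ∈ range dr ∩ ⋂ l, S l := by rw [hdrF]; exact hy
    exact this.1
  have hA₁s : A₁ ⊆ Hq \ range dq := hAu ▸ subset_union_left
  have hA₂s : A₂ ⊆ Hq \ range dq := hAu ▸ subset_union_right
  have hB₁s : B₁ ⊆ Hr \ range dr := hBu ▸ subset_union_left
  have hB₂s : B₂ ⊆ Hr \ range dr := hBu ▸ subset_union_right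
  have hF' : F₂ ∪ F₁ = (⋂ l, S l) \ δ := union_comm F₂ F₁ ▸ hF
  -- a point of a `q`-side lying in `H_r` is on the central surface, on the matching side
  have hcross : ∀ (H H' D Ai Aj Fi Fj : Set X), H ∩ H' ⊆ (⋂ l, S l) → δ ⊆ D →
      Ai ⊆ H \ D → Disjoint Ai Aj → Fj ⊆ Aj → Fi ∪ Fj = (⋂ l, S l) \ δ →
      ∀ y ∈ Ai, y ∈ H' → y ∈ Fi := by
    intro H H' D Ai Aj Fi Fj hHH' hδ hAi hd hFj hFij y hy hyH'
    have hyF : y ∈ (⋂ l, S l) \ δ := ⟨hHH' ⟨(hAi hy).1, hyH'⟩, fun hyδ => (hAi hy).2 (hδ hyδ)⟩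
    rw [← hFij] at hyF
    rcases hyF with h1 | h2
    · exact h1
    · exact absurd (hFj h2) (Set.disjoint_left.1 hd hy)
  have hHH' : Hr ∩ Hq ⊆ ⋂ l, S l := inter_comm Hr Hq ▸ hHH
  have hA₁F : ∀ y ∈ A₁, y ∈ Hr → y ∈ F₁ := hcross Hq Hr _ A₁ A₂ F₁ F₂ hHH hδDq hA₁s hAd hFA₂ hF
  have hA₂F : ∀ y ∈ A₂, y ∈ Hr → y ∈ F₂ :=
    hcross Hq Hr _ A₂ A₁ F₂ F₁ hHH hδDq hA₂s hAd.symm hFA₁ hF'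
  have hB₁F : ∀ y ∈ B₁, y ∈ Hq → y ∈ F₁ := hcross Hr Hq _ B₁ B₂ F₁ F₂ hHH' hδDr hB₁s hBd hFB₂ hF
  have hB₂F : ∀ y ∈ B₂, y ∈ Hq → y ∈ F₂ :=
    hcross Hr Hq _ B₂ B₁ F₂ F₁ hHH' hδDr hB₂s hBd.symm hFB₁ hF'
  -- relative openness of `Aᵢ ∪ Bᵢ` in `H_q ∪ H_r`
  have hopen : ∀ (Ai Bi Fi : Set X), IsOpen (Subtype.val ⁻¹' Ai : Set ↥Hq) →
      IsOpen (Subtype.val ⁻¹' Bi : Set ↥Hr) → (∀ y ∈ Ai, y ∈ Hr → y ∈ Fi) →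
      (∀ y ∈ Bi, y ∈ Hq → y ∈ Fi) → Fi ⊆ Ai → Fi ⊆ Bi → Ai ⊆ Hq → Bi ⊆ Hr →
      IsOpen (Subtype.val ⁻¹' (Ai ∪ Bi) : Set ↥(Hq ∪ Hr)) := by
    intro Ai Bi Fi hAio hBio hAiF hBiF hFA hFB hAiH hBiH
    obtain ⟨Gq, hGqo, hGq⟩ := isOpen_induced_iff.1 hAio
    obtain ⟨Gr, hGro, hGr⟩ := isOpen_induced_iff.1 hBio
    have hGqA : ∀ y ∈ Hq, y ∈ Gq ↔ y ∈ Ai := fun y hy => by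
      have := congrArg (fun s : Set ↥Hq => (⟨y, hy⟩ : ↥Hq) ∈ s) hGq
      exact Iff.of_eq this
    have hGrB : ∀ y ∈ Hr, y ∈ Gr ↔ y ∈ Bi := fun y hy => by
      have := congrArg (fun s : Set ↥Hr => (⟨y, hy⟩ : ↥Hr) ∈ s) hGr
      exact Iff.of_eq this
    rw [isOpen_iff_mem_nhds]
    intro y hy
    have hyA : (y : X) ∈ Hq → (y : X) ∈ Ai := fun hyq => by
      rcases hy with h1 | h2
      · exact h1
      · exact hFA (hBiF _ h2 hyq)
    have hyB : (y : X) ∈ Hr → (y : X) ∈ Bi := fun hyr => by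
      rcases hy with h1 | h2
      · exact hFB (hAiF _ h1 hyr)
      · exact h2
    rw [preimage_coe_mem_nhds_subtype, mem_nhdsWithin]
    refine ⟨(Gq ∪ Hqᶜ) ∩ (Gr ∪ Hrᶜ), (hGqo.union hHqc.isOpen_compl).inter (hGro.union hHrc.isOpen_compl),
      ⟨?_, ?_⟩, ?_⟩
    · by_cases hyq : (y : X) ∈ Hq
      · exact Or.inl ((hGqA _ hyq).2 (hyA hyq))
      · exact Or.inr hyq
    · by_cases hyr : (y : X) ∈ Hr
      · exact Or.inl ((hGrB _ hyr).2 (hyB hyr))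
      · exact Or.inr hyr
    · rintro z ⟨⟨hzq, hzr⟩, hz⟩
      rcases hz with hzHq | hzHr
      · rcases hzq with hzG | hzc
        · exact Or.inl ((hGqA z hzHq).1 hzG)
        · exact absurd hzHq hzc
      · rcases hzr with hzG | hzc
        · exact Or.inr ((hGrB z hzHr).1 hzG)
        · exact absurd hzHr hzc
  -- non-emptiness of the sides of `δ`
  obtain ⟨p₀, hp₀⟩ := hc.nonempty
  have hF₁ne : F₁.Nonempty := closure_nonempty_iff.1 ⟨p₀, hcl₁ hp₀⟩
  have hF₂ne : F₂.Nonempty := closure_nonempty_iff.1 ⟨p₀, hcl₂ hp₀⟩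
  -- the two sides
  have hV₁o := hopen A₁ B₁ F₁ hA₁o hB₁o hA₁F hB₁F hFA₁ hFB₁ (fun y hy => (hA₁s hy).1)
    fun y hy => (hB₁s hy).1
  have hV₂o := hopen A₂ B₂ F₂ hA₂o hB₂o hA₂F hB₂F hFA₂ hFB₂ (fun y hy => (hA₂s hy).1)
    fun y hy => (hB₂s hy).1
  -- sides miss the other disc
  have hAr : ∀ (Ai : Set X), Ai ⊆ Hq \ range dq → ∀ y ∈ Ai, y ∉ range dr := by
    intro Ai hAi y hy hyr
    have hyF : y ∈ ⋂ l, S l := hHH ⟨(hAi hy).1, hdrH hyr⟩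
    have hyδ : y ∈ δ := by rw [← hdrF]; exact ⟨hyr, hyF⟩
    exact (hAi hy).2 (hδDq hyδ)
  have hBq : ∀ (Bi : Set X), Bi ⊆ Hr \ range dr → ∀ y ∈ Bi, y ∉ range dq := by
    intro Bi hBi y hy hyq
    have hyF : y ∈ ⋂ l, S l := hHH ⟨hdqH hyq, (hBi hy).1⟩
    have hyδ : y ∈ δ := by rw [← hdqF]; exact ⟨hyq, hyF⟩
    exact (hBi hy).2 (hδDr hyδ)
  have hunion : (A₁ ∪ B₁) ∪ (A₂ ∪ B₂) = (Hq ∪ Hr) \ (range dq ∪ range dr) := by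
    refine Subset.antisymm ?_ ?_
    · rintro y ((hy | hy) | (hy | hy))
      · exact ⟨Or.inl (hA₁s hy).1, fun h' => h'.elim (hA₁s hy).2 (hAr A₁ hA₁s y hy)⟩
      · exact ⟨Or.inr (hB₁s hy).1, fun h' => h'.elim (hBq B₁ hB₁s y hy) (hB₁s hy).2⟩
      · exact ⟨Or.inl (hA₂s hy).1, fun h' => h'.elim (hA₂s hy).2 (hAr A₂ hA₂s y hy)⟩
      · exact ⟨Or.inr (hB₂s hy).1, fun h' => h'.elim (hBq B₂ hB₂s y hy) (hB₂s hy).2⟩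
    · rintro y ⟨hyH, hyD⟩
      rcases hyH with hyq | hyr
      · have : y ∈ A₁ ∪ A₂ := by rw [hAu]; exact ⟨hyq, fun h' => hyD (Or.inl h')⟩
        rcases this with h1 | h2
        · exact Or.inl (Or.inl h1)
        · exact Or.inr (Or.inl h2)
      · have : y ∈ B₁ ∪ B₂ := by rw [hBu]; exact ⟨hyr, fun h' => hyD (Or.inr h')⟩
        rcases this with h1 | h2
        · exact Or.inl (Or.inr h1)
        · exact Or.inr (Or.inr h2)
  have hdisj : Disjoint (A₁ ∪ B₁) (A₂ ∪ B₂) := by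
    rw [Set.disjoint_left]
    rintro y (hy1 | hy1) (hy2 | hy2)
    · exact Set.disjoint_left.1 hAd hy1 hy2
    · -- `y ∈ A₁ ∩ B₂`: on `F`, in `F₁` and in `F₂`
      exact Set.disjoint_left.1 hF₁₂ (hA₁F y hy1 (hB₂s hy2).1) (hB₂F y hy2 (hA₁s hy1).1)
    · exact Set.disjoint_left.1 hF₁₂ (hB₁F y hy1 (hA₂s hy2).1) (hA₂F y hy2 (hB₁s hy1).1)
    · exact Set.disjoint_left.1 hBd hy1 hy2
  have hclos : ∀ (Ai Bi : Set X), closure Ai = Ai ∪ range dq → closure Bi = Bi ∪ range dr →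
      closure (Ai ∪ Bi) = (Ai ∪ Bi) ∪ (range dq ∪ range dr) := by
    intro Ai Bi hA hB
    rw [closure_union, hA, hB]
    ext y; simp only [mem_union]; tauto
  have hinterF : ∀ (Vi Vj Fi Fj : Set X), Disjoint Vi Vj → Fi ⊆ Vi → Fj ⊆ Vj →
      Fi ∪ Fj = (⋂ l, S l) \ δ → Vi ⊆ (Hq ∪ Hr) \ (range dq ∪ range dr) →
      Vi ∩ (⋂ l, S l) = Fi := by
    intro Vi Vj Fi Fj hd hFi hFj hFij hVi
    refine Subset.antisymm (fun y hy => ?_) fun y hy => ⟨hFi hy, (hFij ▸ Or.inl hy :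
      y ∈ (⋂ l, S l) \ δ).1⟩
    have hyδ : y ∉ δ := fun h' => (hVi hy.1).2 (Or.inl (hδDq h'))
    have : y ∈ Fi ∪ Fj := by rw [hFij]; exact ⟨hy.2, hyδ⟩
    rcases this with h1 | h2
    · exact h1
    · exact absurd (hFj h2) (Set.disjoint_left.1 hd hy.1)
  have hV₁s : A₁ ∪ B₁ ⊆ (Hq ∪ Hr) \ (range dq ∪ range dr) := hunion ▸ subset_union_left
  have hV₂s : A₂ ∪ B₂ ⊆ (Hq ∪ Hr) \ (range dq ∪ range dr) := hunion ▸ subset_union_right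
  refine ⟨A₁ ∪ B₁, A₂ ∪ B₂, hunion, hdisj,
    hA₁c.union (hF₁ne.mono fun y hy => ⟨hFA₁ hy, hFB₁ hy⟩) hB₁c,
    hA₂c.union (hF₂ne.mono fun y hy => ⟨hFA₂ hy, hFB₂ hy⟩) hB₂c, hV₁o, hV₂o,
    hclos A₁ B₁ hAcl₁ hBcl₁, hclos A₂ B₂ hAcl₂ hBcl₂, fun P hP hPc => ?_,
    fun y hy => Or.inl (hFA₁ hy), fun y hy => Or.inl (hFA₂ hy),
    hinterF _ _ F₁ F₂ hdisj (fun y hy => Or.inl (hFA₁ hy)) (fun y hy => Or.inl (hFA₂ hy)) hF hV₁s,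
    hinterF _ _ F₂ F₁ hdisj.symm (fun y hy => Or.inl (hFA₂ hy)) (fun y hy => Or.inl (hFA₁ hy))
      hF' hV₂s⟩
  · -- maximality, in the subspace `H_q ∪ H_r`
    have hPsub : (Subtype.val ⁻¹' P : Set ↥(Hq ∪ Hr)) ⊆
        Subtype.val ⁻¹' (A₁ ∪ B₁) ∪ Subtype.val ⁻¹' (A₂ ∪ B₂) := fun y hy => by
      have : (y : X) ∈ (A₁ ∪ B₁) ∪ (A₂ ∪ B₂) := by rw [hunion]; exact hP hy
      exact this
    have hPpre : IsPreconnected (Subtype.val ⁻¹' P : Set ↥(Hq ∪ Hr)) := by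
      rw [← Topology.IsInducing.subtypeVal.isPreconnected_image, Subtype.image_preimage_coe,
        inter_eq_right.2 fun y hy => (hP hy).1]
      exact hPc
    have hdisj' : Disjoint (Subtype.val ⁻¹' (A₁ ∪ B₁) : Set ↥(Hq ∪ Hr))
        (Subtype.val ⁻¹' (A₂ ∪ B₂)) := hdisj.preimage _
    rcases hPpre.subset_or_subset hV₁o hV₂o hdisj' hPsub with h1 | h2
    · exact Or.inl fun y hy => h1 (show (⟨y, (hP hy).1⟩ : ↥(Hq ∪ Hr)) ∈ Subtype.val ⁻¹' P from hy)
    · exact Or.inr fun y hy => h2 (show (⟨y, (hP hy).1⟩ : ↥(Hq ∪ Hr)) ∈ Subtype.val ⁻¹' P from hy)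

end Disc

end Literature.Topology.FourManifolds

end
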